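import Summits.QuantumAdvantage.QuantumAdvantage.Theorems.CubicForrelationNearExactIsExactBentLOne
import Summits.QuantumAdvantage.QuantumAdvantage.Theorems.CubicForrelationNearExactIsExactFourteenSecondBent

/-!
# Crux `CubicForrelation.NearExactIsExact` (stmt-QuantumAdvantage-14043) — the bent-side line `|S| = 1.5·d_min`: FIBRE STRUCTURE of the
  partner from the 4-flat ladder (`f = A₀A₁A₂ ⊕ γ ⊕ α·A` on `S`, `γ` affine along the fibres)

Certificate seat `b2b-cforr-cert` (gen 44).  HONEST FRAMING: a kernel-checked structure LEMMA (standard axioms, any number of bits and any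
prefix length), the combinatorial core of DISPROOF.md §18.6(a) re-done in the coordinate-free normal form of …KtHalfStructure: NOT summit
progress, no value of `θ₁₄`.  Input: the Kasami–Tokura normal form `(A₀A₁ ⊕ A₂A₃) ∧ ⋀ⱼPⱼ` of `f ⊕ g̃` with its dual vectors `vᵢ`, a base
point `w₀` of the fibre `W₀ = {P = 1, A = 0}`, and the LADDER on parametrised 4-flats inside `{P = 1}` (for `n = 14` this is `kb_ladder_four`,
…BentLadderFourteen): `4 ∣ Σ_ε [Q(x_ε)]·(−1)^{f(x_ε)}`.  Output (`kb_fibre_structure`): Booleans `α₀,…,α₃` and `γ : 𝔽₂ⁿ → 𝔽₂` with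
(i) `γ` AFFINE along `W' = Fix(A) ∩ Fix(P)` from `w₀`: `γ(w₀⊕s⊕t) = γ(w₀⊕s) ⊕ γ(w₀⊕t) ⊕ γ(w₀)`; (ii) on each of the six `Q = 1` cosets of the
fibre, `f(w₀ ⊕ t ⊕ p·v) = p₀p₁p₂ ⊕ γ(w₀ ⊕ t) ⊕ α·p` (`t ∈ W'`).  Mechanism: the ladder on the 4-flats `⟨v₀,v₁,v₂,v₃⟩` (six-point parity),
`⟨vᵢ,vⱼ,v_k,t⟩` (the pattern differences `αᵢ` are constant along `W'`) and `⟨v₀,v₁,s,t⟩` (`γ` affine) — i.e. "`Q·(f ⊕ A₀A₁A₂)` has degree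
`≤ 3` along `U`, hence is `Q·(affine)`" without polynomial algebra.  The successor step (HOME/b2b-cforr-cert-g44/LEAN-GEN44.md): sum over the
fibres to get the plateau `{0, ±4·#W₀}` of `Σ_{x∈S}(−1)^{d(x)+x·y}` and close the `n = 14` line `Φ = 29/32` with `kb_bent_gap_bound`.

* `kb_sum_flat_four`: the sixteen-term expansion of a parametrised 4-flat sum; `kb_sZ_toNat`, `kb_xor4_of_even`, `kb_xor6_of_odd`: parity
  bookkeeping; `kb_fibre_structure`: the structure lemma.

References: T. Kasami, N. Tokura (1970) Thm 1; DISPROOF.md §18.6(a).  Axioms: the standard three.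
-/

set_option linter.dupNamespace false -- D-0017: single-problem summit ⇒ `QuantumAdvantage.QuantumAdvantage` by design

noncomputable section

namespace Summit.QuantumAdvantage.QuantumAdvantage.Theorems.CubicForrelation.NearExactIsExact

open Finset
open Literature.Computability.QuantumComplexity
open Literature.Computability.QuantumComplexity.BuzetChailloux (bxor zeroVec bxor_self bxor_zeroVec zeroVec_bxor bxor_comm
  bxor_bxor_cancel_left)

variable {n : ℕ}

/-! ### Bookkeeping -/

/-- **Sixteen-term expansion of a parametrised 4-flat sum.** [folklore] -/
theorem kb_sum_flat_four (G : (Fin n → Bool) → ℤ) (q a b c d : Fin n → Bool) :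
    ∑ ε : Fin 4 → Bool, G (fun l => q l ^^ decide (Odd #(univ.filter fun i => ε i && (![a, b, c, d] : Fin 4 → Fin n → Bool) i l))) =
      (((G q + G (bxor q d)) + (G (bxor q c) + G (bxor (bxor q d) c))) +
        ((G (bxor q b) + G (bxor (bxor q d) b)) + (G (bxor (bxor q c) b) + G (bxor (bxor (bxor q d) c) b)))) +
      (((G (bxor q a) + G (bxor (bxor q d) a)) + (G (bxor (bxor q c) a) + G (bxor (bxor (bxor q d) c) a))) +
        ((G (bxor (bxor q b) a) + G (bxor (bxor (bxor q d) b) a)) +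
          (G (bxor (bxor (bxor q c) b) a) + G (bxor (bxor (bxor (bxor q d) c) b) a)))) := by
  have two : ∀ (H : (Fin n → Bool) → ℤ), ∑ ε : Fin 2 → Bool,
      H (fun l => q l ^^ decide (Odd #(univ.filter fun i => ε i && (![c, d] : Fin 2 → Fin n → Bool) i l))) =
      (H q + H (bxor q d)) + (H (bxor q c) + H (bxor (bxor q d) c)) := by
    intro H
    rw [fr_sum_peel H q c ![d], fr_sum_peel H q d ![], fr_sum_peel (fun z => H (bxor z c)) q d ![]]
    simp only [univ_unique, sum_singleton, tep_flatPt_nil]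
  have three : ∀ (H : (Fin n → Bool) → ℤ), ∑ ε : Fin 3 → Bool,
      H (fun l => q l ^^ decide (Odd #(univ.filter fun i => ε i && (![b, c, d] : Fin 3 → Fin n → Bool) i l))) =
      ((H q + H (bxor q d)) + (H (bxor q c) + H (bxor (bxor q d) c))) +
        ((H (bxor q b) + H (bxor (bxor q d) b)) + (H (bxor (bxor q c) b) + H (bxor (bxor (bxor q d) c) b))) := by
    intro H
    rw [fr_sum_peel H q b ![c, d], two H, two (fun z => H (bxor z b))]
  rw [fr_sum_peel G q a ![b, c, d], three G, three (fun z => G (bxor z a))]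

/-- `sZ b = 1 − 2·[b]`. [folklore] -/
theorem kb_sZ_toNat (b : Bool) : sZ b = 1 - 2 * (b.toNat : ℤ) := by
  cases b <;> simp [sZ]

/-- Four Booleans with an even number of `true`s have xor `false`. [folklore] -/
theorem kb_xor4_of_even (b₁ b₂ b₃ b₄ : Bool) (h : (b₁.toNat + b₂.toNat + b₃.toNat + b₄.toNat) % 2 = 0) :
    ((b₁ ^^ b₂) ^^ (b₃ ^^ b₄)) = false := by
  revert h b₁ b₂ b₃ b₄; decide

/-- Six Booleans with an odd number of `true`s have xor `true`. [folklore] -/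
theorem kb_xor6_of_odd (b₁ b₂ b₃ b₄ b₅ b₆ : Bool) (h : (b₁.toNat + b₂.toNat + b₃.toNat + b₄.toNat + b₅.toNat + b₆.toNat) % 2 = 1) :
    (((b₁ ^^ b₂) ^^ (b₃ ^^ b₄)) ^^ (b₅ ^^ b₆)) = true := by
  revert h b₁ b₂ b₃ b₄ b₅ b₆; decide

/-! ### The fibre structure -/

/-- **Fibre structure of the partner on `S`** (see the module header).  Hypotheses: the normal-form data `A, P, v` (duals `vᵢ` flip exactly
`Aᵢ` and fix `P`), a base point `w₀` with `P(w₀) = 1`, `A(w₀) = 0`, and the ladder on every parametrised 4-flat inside `{P = 1}`.  Conclusion: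
Booleans `α₀,…,α₃` and `γ` with `γ` affine along `W' = Fix(A) ∩ Fix(P)` from `w₀` and the six pattern equations
`f = p₀p₁p₂ ⊕ γ ⊕ α·p` on the `Q = 1` cosets of every fibre `w₀ ⊕ t`, `t ∈ W'`. [this work; cite: KasamiTokura1970, Thm 1] -/
theorem kb_fibre_structure {s : ℕ} (f : (Fin n → Bool) → Bool) (A : Fin 4 → (Fin n → Bool) → Bool) (P : Fin s → (Fin n → Bool) → Bool)
    (v : Fin 4 → Fin n → Bool)
    (hAv : ∀ i x, A i (bxor x (v i)) = !A i x) (hAv' : ∀ i k x, i ≠ k → A i (bxor x (v k)) = A i x)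
    (hPv : ∀ j k x, P j (bxor x (v k)) = P j x)
    (w₀ : Fin n → Bool) (hw₀P : ∀ j, P j w₀ = true) (hw₀A : ∀ i, A i w₀ = false)
    (hlad : ∀ q, (∀ j, P j q = true) → ∀ a : Fin 4 → Fin n → Bool, (∀ i j x, P j (bxor x (a i)) = P j x) →
      (4 : ℤ) ∣ ∑ ε : Fin 4 → Bool,
        (if ((A 0 (fun l => q l ^^ decide (Odd #(univ.filter fun i => ε i && a i l))) &&
              A 1 (fun l => q l ^^ decide (Odd #(univ.filter fun i => ε i && a i l)))) ^^
             (A 2 (fun l => q l ^^ decide (Odd #(univ.filter fun i => ε i && a i l))) &&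
              A 3 (fun l => q l ^^ decide (Odd #(univ.filter fun i => ε i && a i l))))) = true
          then sZ (f (fun l => q l ^^ decide (Odd #(univ.filter fun i => ε i && a i l)))) else 0)) :
    ∃ (α₀ α₁ α₂ α₃ : Bool) (γ : (Fin n → Bool) → Bool),
      (∀ s' t, (∀ i x, A i (bxor x s') = A i x) → (∀ j x, P j (bxor x s') = P j x) →
        (∀ i x, A i (bxor x t) = A i x) → (∀ j x, P j (bxor x t) = P j x) →
        γ (bxor (bxor w₀ s') t) = ((γ (bxor w₀ s') ^^ γ (bxor w₀ t)) ^^ γ w₀)) ∧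
      ∀ t, (∀ i x, A i (bxor x t) = A i x) → (∀ j x, P j (bxor x t) = P j x) →
        f (bxor (bxor (bxor w₀ t) (v 1)) (v 0)) = (γ (bxor w₀ t) ^^ (α₀ ^^ α₁)) ∧
        f (bxor (bxor (bxor (bxor w₀ t) (v 2)) (v 1)) (v 0)) = ((true ^^ γ (bxor w₀ t)) ^^ ((α₀ ^^ α₁) ^^ α₂)) ∧
        f (bxor (bxor (bxor (bxor w₀ t) (v 3)) (v 1)) (v 0)) = (γ (bxor w₀ t) ^^ ((α₀ ^^ α₁) ^^ α₃)) ∧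
        f (bxor (bxor (bxor w₀ t) (v 3)) (v 2)) = (γ (bxor w₀ t) ^^ (α₂ ^^ α₃)) ∧
        f (bxor (bxor (bxor (bxor w₀ t) (v 3)) (v 2)) (v 0)) = (γ (bxor w₀ t) ^^ ((α₀ ^^ α₂) ^^ α₃)) ∧
        f (bxor (bxor (bxor (bxor w₀ t) (v 3)) (v 2)) (v 1)) = (γ (bxor w₀ t) ^^ ((α₁ ^^ α₂) ^^ α₃)) := by
  classical
  -- shift rules for the duals
  have r01 : ∀ x, A 0 (bxor x (v 1)) = A 0 x := fun x => hAv' 0 1 x (by decide)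
  have r02 : ∀ x, A 0 (bxor x (v 2)) = A 0 x := fun x => hAv' 0 2 x (by decide)
  have r03 : ∀ x, A 0 (bxor x (v 3)) = A 0 x := fun x => hAv' 0 3 x (by decide)
  have r10 : ∀ x, A 1 (bxor x (v 0)) = A 1 x := fun x => hAv' 1 0 x (by decide)
  have r12 : ∀ x, A 1 (bxor x (v 2)) = A 1 x := fun x => hAv' 1 2 x (by decide)
  have r13 : ∀ x, A 1 (bxor x (v 3)) = A 1 x := fun x => hAv' 1 3 x (by decide)
  have r20 : ∀ x, A 2 (bxor x (v 0)) = A 2 x := fun x => hAv' 2 0 x (by decide)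
  have r21 : ∀ x, A 2 (bxor x (v 1)) = A 2 x := fun x => hAv' 2 1 x (by decide)
  have r23 : ∀ x, A 2 (bxor x (v 3)) = A 2 x := fun x => hAv' 2 3 x (by decide)
  have r30 : ∀ x, A 3 (bxor x (v 0)) = A 3 x := fun x => hAv' 3 0 x (by decide)
  have r31 : ∀ x, A 3 (bxor x (v 1)) = A 3 x := fun x => hAv' 3 1 x (by decide)
  have r32 : ∀ x, A 3 (bxor x (v 2)) = A 3 x := fun x => hAv' 3 2 x (by decide)
  have f0 := hAv 0
  have f1 := hAv 1
  have f2 := hAv 2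
  have f3 := hAv 3
  set G : (Fin n → Bool) → ℤ := fun z => if ((A 0 z && A 1 z) ^^ (A 2 z && A 3 z)) = true then sZ (f z) else 0 with hG
  have hlad' : ∀ q, (∀ j, P j q = true) → ∀ a : Fin 4 → Fin n → Bool, (∀ i j x, P j (bxor x (a i)) = P j x) →
      (4 : ℤ) ∣ ∑ ε : Fin 4 → Bool, G (fun l => q l ^^ decide (Odd #(univ.filter fun i => ε i && a i l))) := by
    intro q hq a ha
    simpa only [hG] using hlad q hq a ha
  -- (L1) the six-point parity on the fibre `w₀ ⊕ t`
  have L1 : ∀ t, (∀ i x, A i (bxor x t) = A i x) → (∀ j x, P j (bxor x t) = P j x) →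
      (((f (bxor (bxor (bxor w₀ t) (v 3)) (v 2)) ^^ f (bxor (bxor (bxor (bxor w₀ t) (v 3)) (v 2)) (v 1))) ^^
        (f (bxor (bxor (bxor (bxor w₀ t) (v 3)) (v 2)) (v 0)) ^^ f (bxor (bxor (bxor w₀ t) (v 1)) (v 0)))) ^^
        (f (bxor (bxor (bxor (bxor w₀ t) (v 3)) (v 1)) (v 0)) ^^ f (bxor (bxor (bxor (bxor w₀ t) (v 2)) (v 1)) (v 0)))) = true := by
    intro t htA htP
    have h := hlad' (bxor w₀ t) (fun j => by rw [htP]; exact hw₀P j) ![v 0, v 1, v 2, v 3]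
      (fun i j x => by fin_cases i <;> exact hPv j _ x)
    rw [kb_sum_flat_four G] at h
    simp only [hG, f0, f1, f2, f3, r01, r02, r03, r10, r12, r13, r20, r21, r23, r30, r31, r32, htA, hw₀A,
      Bool.not_false, Bool.not_true, Bool.and_true, Bool.and_false, Bool.xor_true, Bool.xor_false,
      if_true, if_false, Bool.false_eq_true, add_zero, zero_add, kb_sZ_toNat] at h
    apply kb_xor6_of_odd
    omega
  -- (L2) the pattern differences are constant along `W'`
  have L2 : ∀ t, (∀ i x, A i (bxor x t) = A i x) → (∀ j x, P j (bxor x t) = P j x) →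
      ((f (bxor (bxor w₀ (v 1)) (v 0)) ^^ f (bxor (bxor (bxor w₀ (v 2)) (v 1)) (v 0))) ^^
        (f (bxor (bxor (bxor w₀ t) (v 1)) (v 0)) ^^ f (bxor (bxor (bxor (bxor w₀ t) (v 2)) (v 1)) (v 0)))) = false ∧
      ((f (bxor (bxor w₀ (v 1)) (v 0)) ^^ f (bxor (bxor (bxor w₀ (v 3)) (v 1)) (v 0))) ^^
        (f (bxor (bxor (bxor w₀ t) (v 1)) (v 0)) ^^ f (bxor (bxor (bxor (bxor w₀ t) (v 3)) (v 1)) (v 0)))) = false ∧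
      ((f (bxor (bxor w₀ (v 3)) (v 2)) ^^ f (bxor (bxor (bxor w₀ (v 3)) (v 2)) (v 0))) ^^
        (f (bxor (bxor (bxor w₀ t) (v 3)) (v 2)) ^^ f (bxor (bxor (bxor (bxor w₀ t) (v 3)) (v 2)) (v 0)))) = false ∧
      ((f (bxor (bxor w₀ (v 3)) (v 2)) ^^ f (bxor (bxor (bxor w₀ (v 3)) (v 2)) (v 1))) ^^
        (f (bxor (bxor (bxor w₀ t) (v 3)) (v 2)) ^^ f (bxor (bxor (bxor (bxor w₀ t) (v 3)) (v 2)) (v 1)))) = false := by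
    intro t htA htP
    have hPa : ∀ (c : Fin 4 → Fin n → Bool), (∀ i, (c i = v 0 ∨ c i = v 1 ∨ c i = v 2 ∨ c i = v 3) ∨ c i = t) →
        ∀ i j x, P j (bxor x (c i)) = P j x := by
      intro c hc i j x
      rcases hc i with (h | h | h | h) | h <;> rw [h]
      · exact hPv j 0 x
      · exact hPv j 1 x
      · exact hPv j 2 x
      · exact hPv j 3 x
      · exact htP j x
    refine ⟨?_, ?_, ?_, ?_⟩
    · have h := hlad' w₀ hw₀P ![v 0, v 1, v 2, t] (hPa _ (fun i => by fin_cases i <;> simp))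
      rw [kb_sum_flat_four G] at h
      simp only [hG, f0, f1, f2, r01, r02, r10, r12, r20, r21, r30, r31, r32, htA, hw₀A,
        Bool.not_false, Bool.and_true, Bool.and_false, Bool.xor_false,
        if_true, if_false, Bool.false_eq_true, add_zero, zero_add, kb_sZ_toNat] at h
      apply kb_xor4_of_even
      omega
    · have h := hlad' w₀ hw₀P ![v 0, v 1, v 3, t] (hPa _ (fun i => by fin_cases i <;> simp))
      rw [kb_sum_flat_four G] at h
      simp only [hG, f0, f1, f3, r01, r03, r10, r13, r20, r21, r23, r30, r31, htA, hw₀A,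
        Bool.not_false, Bool.and_true, Bool.and_false, Bool.xor_false,
        if_true, if_false, Bool.false_eq_true, add_zero, zero_add, kb_sZ_toNat] at h
      apply kb_xor4_of_even
      omega
    · have h := hlad' w₀ hw₀P ![v 0, v 2, v 3, t] (hPa _ (fun i => by fin_cases i <;> simp))
      rw [kb_sum_flat_four G] at h
      simp only [hG, f0, f2, f3, r02, r03, r10, r12, r13, r20, r23, r30, r32, htA, hw₀A,
        Bool.not_false, Bool.and_true, Bool.and_false, Bool.xor_true, Bool.xor_false,
        if_true, if_false, Bool.false_eq_true, add_zero, zero_add, kb_sZ_toNat] at h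
      apply kb_xor4_of_even
      omega
    · have h := hlad' w₀ hw₀P ![v 1, v 2, v 3, t] (hPa _ (fun i => by fin_cases i <;> simp))
      rw [kb_sum_flat_four G] at h
      simp only [hG, f1, f2, f3, r01, r02, r03, r12, r13, r21, r23, r31, r32, htA, hw₀A,
        Bool.not_false, Bool.and_true, Bool.and_false, Bool.xor_true, Bool.xor_false,
        if_true, if_false, Bool.false_eq_true, add_zero, zero_add, kb_sZ_toNat] at h
      apply kb_xor4_of_even
      omega
  -- (L3) `γ` is affine along `W'`
  have L3 : ∀ s' t, (∀ i x, A i (bxor x s') = A i x) → (∀ j x, P j (bxor x s') = P j x) →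
      (∀ i x, A i (bxor x t) = A i x) → (∀ j x, P j (bxor x t) = P j x) →
      ((f (bxor (bxor w₀ (v 1)) (v 0)) ^^ f (bxor (bxor (bxor w₀ s') (v 1)) (v 0))) ^^
        (f (bxor (bxor (bxor w₀ t) (v 1)) (v 0)) ^^ f (bxor (bxor (bxor (bxor w₀ s') t) (v 1)) (v 0)))) = false := by
    intro s' t hsA hsP htA htP
    have h := hlad' w₀ hw₀P ![v 0, v 1, t, s'] (fun i j x => by
      fin_cases i
      · exact hPv j 0 x
      · exact hPv j 1 x
      · exact htP j x
      · exact hsP j x)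
    rw [kb_sum_flat_four G] at h
    simp only [hG, f0, f1, r01, r10, r20, r21, r30, r31, htA, hsA, hw₀A,
      Bool.not_false, Bool.and_true, Bool.and_false, Bool.xor_false,
      if_true, if_false, Bool.false_eq_true, add_zero, zero_add, kb_sZ_toNat] at h
    apply kb_xor4_of_even
    omega
  -- the constants and `γ`
  refine ⟨f (bxor (bxor w₀ (v 3)) (v 2)) ^^ f (bxor (bxor (bxor w₀ (v 3)) (v 2)) (v 0)),
    f (bxor (bxor w₀ (v 3)) (v 2)) ^^ f (bxor (bxor (bxor w₀ (v 3)) (v 2)) (v 1)),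
    !(f (bxor (bxor w₀ (v 1)) (v 0)) ^^ f (bxor (bxor (bxor w₀ (v 2)) (v 1)) (v 0))),
    f (bxor (bxor w₀ (v 1)) (v 0)) ^^ f (bxor (bxor (bxor w₀ (v 3)) (v 1)) (v 0)),
    fun w => f (bxor (bxor w (v 1)) (v 0)) ^^
      ((f (bxor (bxor w₀ (v 3)) (v 2)) ^^ f (bxor (bxor (bxor w₀ (v 3)) (v 2)) (v 0))) ^^
       (f (bxor (bxor w₀ (v 3)) (v 2)) ^^ f (bxor (bxor (bxor w₀ (v 3)) (v 2)) (v 1)))),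
    fun s' t hsA hsP htA htP => ?_, fun t htA htP => ?_⟩
  · have h := L3 s' t hsA hsP htA htP
    revert h
    beta_reduce
    generalize f (bxor (bxor w₀ (v 1)) (v 0)) = b1
    generalize f (bxor (bxor (bxor w₀ s') (v 1)) (v 0)) = b2
    generalize f (bxor (bxor (bxor w₀ t) (v 1)) (v 0)) = b3
    generalize f (bxor (bxor (bxor (bxor w₀ s') t) (v 1)) (v 0)) = b4
    generalize ((f (bxor (bxor w₀ (v 3)) (v 2)) ^^ f (bxor (bxor (bxor w₀ (v 3)) (v 2)) (v 0))) ^^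
       (f (bxor (bxor w₀ (v 3)) (v 2)) ^^ f (bxor (bxor (bxor w₀ (v 3)) (v 2)) (v 1)))) = c
    revert b1 b2 b3 b4 c
    decide
  · have h1 := L1 t htA htP
    obtain ⟨c2, c3, c0, c1⟩ := L2 t htA htP
    revert h1 c2 c3 c0 c1
    beta_reduce
    generalize f (bxor (bxor w₀ (v 1)) (v 0)) = E1
    generalize f (bxor (bxor (bxor w₀ (v 2)) (v 1)) (v 0)) = E2
    generalize f (bxor (bxor (bxor w₀ (v 3)) (v 1)) (v 0)) = E3
    generalize f (bxor (bxor w₀ (v 3)) (v 2)) = E4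
    generalize f (bxor (bxor (bxor w₀ (v 3)) (v 2)) (v 0)) = E5
    generalize f (bxor (bxor (bxor w₀ (v 3)) (v 2)) (v 1)) = E6
    generalize f (bxor (bxor (bxor w₀ t) (v 1)) (v 0)) = F1
    generalize f (bxor (bxor (bxor (bxor w₀ t) (v 2)) (v 1)) (v 0)) = F2
    generalize f (bxor (bxor (bxor (bxor w₀ t) (v 3)) (v 1)) (v 0)) = F3
    generalize f (bxor (bxor (bxor w₀ t) (v 3)) (v 2)) = F4
    generalize f (bxor (bxor (bxor (bxor w₀ t) (v 3)) (v 2)) (v 0)) = F5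
    generalize f (bxor (bxor (bxor (bxor w₀ t) (v 3)) (v 2)) (v 1)) = F6
    revert E1 E2 E3 E4 E5 E6 F1 F2 F3 F4 F5 F6
    decide

end Summit.QuantumAdvantage.QuantumAdvantage.Theorems.CubicForrelation.NearExactIsExact

end
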